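import Literature.AlgebraicGeometry.Resolution.RsopMonomialIdeals
import Literature.AlgebraicGeometry.Resolution.StrictNormalCrossingsDescent
import HarnessLib

/-!
# Crux `PatchingRelPerfect` (stmt-ResolutionOfSingularities-16161), chain W5.2 — T6-E1b residual `LegalScopedDivisorReduction₃`,
# PHASE 2 closer (2b), spec D4 sub-lemma L4: THE CHOICE OF THE SECOND GENERATOR `g ∈ {z, u}`

[OURS · L1 W5.2 · res-L1-w52-lead-1 g5, hand #3b; spec `L/res-L1-w52-lead-1/PHASE2-STEPB-SPEC.md` §D4 ORACLE PLAN, step (ii), L4]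
Replaces the role of NO printed item; NOT a statement of the manuscript under review; fact-free, pure commutative algebra.

The pointwise assembly (…DepthLegalCurvePoint) wants `g ∈ 𝓘(Γ)_y = (z, u)` outside `J + 𝔪²`, `J` = the equations of the members
through `y`.  Cotangent counts in a regular local ring (`Σ cᵢ wᵢ ∈ 𝔪² ⇒ cᵢ ∈ 𝔪` for a part `w` of a regular system of parameters,
`coeff_mem_maximalIdeal_of_sum_mem_sq`):
* ONE member `F₁ = (f)` through `y` (`exists_not_mem_span_singleton_sup_sq`): one of `w₀, w₁` is not in `(f) + 𝔪²` — for ANY `f ∈ 𝔪`;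
* TWO members `F₁ = (f) ⊇ Γ`, `F = (h) ⊉ Γ` through `y`, in coordinates `t = (z, u_p, u_q)` (host, the branch `Γ`, the other branch `Γ′`
  of the trace divisor): `f ∈ (z, u_p)`, `h ∈ (z, u_q)` NOT tangent to the host (`h ∉ (z) + 𝔪²`) ⇒ one of `z, u_p` is not in
  `(f) + (h) + 𝔪²` (`exists_not_mem_span_pair_sup_sq`).

AI-written; AI review is weaker than expert review.

## References
* H. Matsumura, *Commutative Ring Theory* (1986), Thm. 14.2. [Matsumura1987]
-/

-- `Summit.<Summit>.<Sub>.Theorems` with `Sub = Summit` (single-conjunct summit, D-0017)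
set_option linter.dupNamespace false

noncomputable section

open IsLocalRing Literature.AlgebraicGeometry.Resolution

namespace Summit.ResolutionOfSingularities.ResolutionOfSingularities.Theorems

universe u

namespace DepthLegal

variable {R : Type u} [CommRing R] [IsLocalRing R]

/-- **A part of a regular system of parameters is linearly independent modulo `𝔪²`.** [cite: Matsumura1987, Thm. 14.2] -/
theorem coeff_mem_maximalIdeal_of_sum_mem_sq {n : ℕ} {w : Fin n → R} (hw : IsRsopPart w) (c : Fin n → R)
    (hc : ∑ i, c i * w i ∈ maximalIdeal R ^ 2) (i : Fin n) : c i ∈ maximalIdeal R := by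
  obtain ⟨hreg, e, y, hdim, hspan⟩ := hw
  haveI := hreg
  refine mem_maximalIdeal_of_sum_mul_mem_sq_of_rsop w y hdim hspan c (fun _ => 0) ?_ i
  simpa only [zero_mul, Finset.sum_const_zero, add_zero] using hc

/-- Products of two elements of `𝔪` lie in `𝔪²`. [folklore] -/
theorem mul_mem_sq {p q : R} (hp : p ∈ maximalIdeal R) (hq : q ∈ maximalIdeal R) : p * q ∈ maximalIdeal R ^ 2 := by
  rw [pow_two]; exact Ideal.mul_mem_mul hp hq

/-- Membership in `(f) + 𝔪²`, unfolded. [folklore] -/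
theorem mem_span_singleton_sup_sq_iff {f x : R} :
    x ∈ Ideal.span {f} ⊔ maximalIdeal R ^ 2 ↔ ∃ a m, m ∈ maximalIdeal R ^ 2 ∧ x = a * f + m := by
  constructor
  · intro h
    obtain ⟨y, hy, m, hm, rfl⟩ := Submodule.mem_sup.mp h
    obtain ⟨a, rfl⟩ := Ideal.mem_span_singleton'.mp hy
    exact ⟨a, m, hm, rfl⟩
  · rintro ⟨a, m, hm, rfl⟩
    exact Submodule.add_mem_sup (Ideal.mem_span_singleton'.mpr ⟨a, rfl⟩) hm

/-- [OURS · L1 W5.2] **L4, one member**: for a two-element part `w` of a regular system of parameters and any `f ∈ 𝔪`, one of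
`w₀, w₁` does not lie in `(f) + 𝔪²`. [cite: Matsumura1987, Thm. 14.2] -/
theorem exists_not_mem_span_singleton_sup_sq {w : Fin 2 → R} (hw : IsRsopPart w) {f : R} (hf : f ∈ maximalIdeal R) :
    ∃ i : Fin 2, w i ∉ Ideal.span {f} ⊔ maximalIdeal R ^ 2 := by
  by_contra hall
  simp only [not_exists, not_not] at hall
  obtain ⟨α, m, hm, h0⟩ := mem_span_singleton_sup_sq_iff.mp (hall 0)
  obtain ⟨β, m', hm', h1⟩ := mem_span_singleton_sup_sq_iff.mp (hall 1)
  -- `β w₀ - α w₁ ∈ 𝔪²`, so `α, β ∈ 𝔪`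
  have hrel : ∑ i, (![β, -α] : Fin 2 → R) i * w i ∈ maximalIdeal R ^ 2 := by
    have : ∑ i, (![β, -α] : Fin 2 → R) i * w i = β * m - α * m' := by
      rw [Fin.sum_univ_two, Matrix.cons_val_zero, Matrix.cons_val_one, Matrix.cons_val_fin_one]
      rw [h0, h1]; ring
    rw [this]
    exact Ideal.sub_mem _ (Ideal.mul_mem_left _ _ hm) (Ideal.mul_mem_left _ _ hm')
  have hα : α ∈ maximalIdeal R := by
    have h := coeff_mem_maximalIdeal_of_sum_mem_sq hw _ hrel 1
    simp only [Matrix.cons_val_one, Matrix.cons_val_fin_one] at h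
    exact neg_mem_iff.mp h
  -- then `w₀ = α f + m ∈ 𝔪²`
  exact hw.not_mem_sq 0 (h0 ▸ Ideal.add_mem _ (mul_mem_sq hα hf) hm)

/-- [OURS · L1 W5.2] **L4, two members**: in coordinates `t = (z, u_p, u_q)` (part of a regular system of parameters), if
`f ∈ (z, u_p)` and `h ∈ (z, u_q)` with `h ∉ (z) + 𝔪²` (the second member is not tangent to the host `z = 0`), then one of `z, u_p`
does not lie in `(f) + (h) + 𝔪²`. [cite: Matsumura1987, Thm. 14.2] -/
theorem exists_not_mem_span_pair_sup_sq {t : Fin 3 → R} (ht : IsRsopPart t) {f h : R}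
    (hf : f ∈ Ideal.span {t 0, t 1}) (hh : h ∈ Ideal.span {t 0, t 2}) (hhz : h ∉ Ideal.span {t 0} ⊔ maximalIdeal R ^ 2) :
    ∃ i : Fin 2, t (Fin.castSucc i) ∉ Ideal.span {f} ⊔ Ideal.span {h} ⊔ maximalIdeal R ^ 2 := by
  have ht0 : t 0 ∈ maximalIdeal R := ht.mem_maximalIdeal 0
  obtain ⟨a, b, rfl⟩ := Ideal.mem_span_pair.mp hf
  obtain ⟨a', e, rfl⟩ := Ideal.mem_span_pair.mp hh
  -- `e` is a unit (non-tangency)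
  have he : IsUnit e := by
    by_contra he
    exact hhz (Submodule.add_mem_sup (Ideal.mem_span_singleton'.mpr ⟨a', rfl⟩)
      (mul_mem_sq ((mem_maximalIdeal _).mpr he) (ht.mem_maximalIdeal 2)))
  -- membership in `(f) + (h) + 𝔪²`, unfolded
  have hmem : ∀ {x : R}, x ∈ Ideal.span {a * t 0 + b * t 1} ⊔ Ideal.span {a' * t 0 + e * t 2} ⊔ maximalIdeal R ^ 2 →
      ∃ α β m, m ∈ maximalIdeal R ^ 2 ∧ x = α * (a * t 0 + b * t 1) + β * (a' * t 0 + e * t 2) + m := by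
    intro x hx
    obtain ⟨y, hy, m, hm, rfl⟩ := Submodule.mem_sup.mp hx
    obtain ⟨y₁, hy₁, y₂, hy₂, rfl⟩ := Submodule.mem_sup.mp hy
    obtain ⟨α, rfl⟩ := Ideal.mem_span_singleton'.mp hy₁
    obtain ⟨β, rfl⟩ := Ideal.mem_span_singleton'.mp hy₂
    exact ⟨α, β, m, hm, rfl⟩
  by_contra hall
  simp only [not_exists, not_not] at hall
  have h0 := hall 0
  have h1 := hall 1
  simp only [Fin.castSucc_zero] at h0
  rw [show Fin.castSucc (1 : Fin 2) = (1 : Fin 3) from rfl] at h1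
  obtain ⟨α, β, m, hm, h0⟩ := hmem h0
  obtain ⟨α', β', m', hm', h1⟩ := hmem h1
  -- the two cotangent relations
  have hrel0 : ∑ i, (![α * a + β * a' - 1, α * b, β * e] : Fin 3 → R) i * t i ∈ maximalIdeal R ^ 2 := by
    have : ∑ i, (![α * a + β * a' - 1, α * b, β * e] : Fin 3 → R) i * t i = -m := by
      rw [Fin.sum_univ_three]
      simp only [Matrix.cons_val_zero, Matrix.cons_val_one, Matrix.cons_val_two, Matrix.head_cons, Matrix.tail_cons]
      linear_combination (-1 : R) * h0
    rw [this]; exact neg_mem_iff.mpr hm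
  have hrel1 : ∑ i, (![α' * a + β' * a', α' * b - 1, β' * e] : Fin 3 → R) i * t i ∈ maximalIdeal R ^ 2 := by
    have : ∑ i, (![α' * a + β' * a', α' * b - 1, β' * e] : Fin 3 → R) i * t i = -m' := by
      rw [Fin.sum_univ_three]
      simp only [Matrix.cons_val_zero, Matrix.cons_val_one, Matrix.cons_val_two, Matrix.head_cons, Matrix.tail_cons]
      linear_combination (-1 : R) * h1
    rw [this]; exact neg_mem_iff.mpr hm'
  have c00 := coeff_mem_maximalIdeal_of_sum_mem_sq ht _ hrel0 0
  have c01 := coeff_mem_maximalIdeal_of_sum_mem_sq ht _ hrel0 1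
  have c02 := coeff_mem_maximalIdeal_of_sum_mem_sq ht _ hrel0 2
  have c10 := coeff_mem_maximalIdeal_of_sum_mem_sq ht _ hrel1 0
  have c11 := coeff_mem_maximalIdeal_of_sum_mem_sq ht _ hrel1 1
  have c12 := coeff_mem_maximalIdeal_of_sum_mem_sq ht _ hrel1 2
  simp only [Matrix.cons_val_zero, Matrix.cons_val_one, Matrix.cons_val_two, Matrix.head_cons, Matrix.tail_cons]
    at c00 c01 c02 c10 c11 c12
  -- `c11 : α' b - 1 ∈ 𝔪` ⇒ `α' b` is a unit ⇒ `b`, `α'` units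
  have hαb : IsUnit (α' * b) := by
    by_contra hu
    exact (maximalIdeal.isMaximal R).ne_top
      (Ideal.eq_top_of_isUnit_mem _ (by simpa using Ideal.sub_mem _ ((mem_maximalIdeal _).mpr hu) c11) isUnit_one)
  have hb : IsUnit b := isUnit_of_mul_isUnit_right hαb
  have hα' : IsUnit α' := isUnit_of_mul_isUnit_left hαb
  -- `c12 : β' e ∈ 𝔪`, `e` unit ⇒ `β' ∈ 𝔪`; `c10` ⇒ `α' a ∈ 𝔪` ⇒ `a ∈ 𝔪`
  have hβ' : β' ∈ maximalIdeal R := by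
    obtain ⟨e', he'⟩ := he.exists_right_inv
    have := Ideal.mul_mem_right e' _ c12
    rwa [mul_assoc, he', mul_one] at this
  have ha : a ∈ maximalIdeal R := by
    have h2 : α' * a ∈ maximalIdeal R := by
      have := Ideal.sub_mem _ c10 (Ideal.mul_mem_right a' _ hβ')
      rwa [add_sub_cancel_right] at this
    obtain ⟨i', hi'⟩ := hα'.exists_left_inv
    have := Ideal.mul_mem_left _ i' h2
    rwa [← mul_assoc, hi', one_mul] at this
  -- `c01 : α b ∈ 𝔪`, `b` unit ⇒ `α ∈ 𝔪`; `c02 : β e ∈ 𝔪` ⇒ `β ∈ 𝔪`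
  have hα : α ∈ maximalIdeal R := by
    obtain ⟨b', hb'⟩ := hb.exists_right_inv
    have := Ideal.mul_mem_right b' _ c01
    rwa [mul_assoc, hb', mul_one] at this
  have hβ : β ∈ maximalIdeal R := by
    obtain ⟨e', he'⟩ := he.exists_right_inv
    have := Ideal.mul_mem_right e' _ c02
    rwa [mul_assoc, he', mul_one] at this
  -- `c00 : α a + β a' - 1 ∈ 𝔪` with `α a, β a' ∈ 𝔪` ⇒ `1 ∈ 𝔪`
  have h1m : (1 : R) ∈ maximalIdeal R := by
    have := Ideal.sub_mem _ (Ideal.add_mem _ (Ideal.mul_mem_right a _ hα) (Ideal.mul_mem_right a' _ hβ)) c00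
    rwa [sub_sub_cancel] at this
  exact (maximalIdeal.isMaximal R).ne_top (Ideal.eq_top_of_isUnit_mem _ h1m isUnit_one)

end DepthLegal

end Summit.ResolutionOfSingularities.ResolutionOfSingularities.Theorems
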